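import Summits.MatrixMultiplication.OmegaCensus.STPPSmallPatternT1K11OrderLaw
import Summits.MatrixMultiplication.OmegaCensus.STPPSmallPatternEvenOrderLift
import Summits.MatrixMultiplication.OmegaCensus.STPPSmallPatternCyclicFatLifts

/-!
# ω-census, small pattern `(1,2,2)¹¹`: even-order hosts from `164` — the fat lifts of the `(2,1,1)¹¹` order-82 law (kernel)

Cell `pub-omega`, ω construction census, seat pub-omega ENG2 (gen 36). HONEST FRAMING (verbatim): lottery ticket; floor =
certified bounds/negative ranges.  Census STRUCTURE bookkeeping (row B5, column `T2` at `k = 11`; conjecture C10 (a) LIFT-TIGHT); nothing here bears on `ω`.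

The `T2` column of record at `k = 11` read «every finite abelian group of order `≥ 204` hosts `(1,2,2)¹¹`» (stpp-3's all-abelian law).
The new `T1` law `exists_isSTPP_211pow11_of_card_ge_82` and the cyclic ray `exists_isSTPP_211pow11_zmod_of_le82` give, by the tree's lifts:

* `exists_isSTPP_122pow11_zmod_two_mul` — **`(1,2,2)¹¹ ⊆ ℤ/2n` for every `n ≥ 82`**;
* `exists_isSTPP_122pow11_of_even_card_ge_164` — **every finite abelian group of EVEN order `≥ 164` hosts `(1,2,2)¹¹`** (new for the even orders
  `164 … 202`);
* `exists_isSTPP_222pow11_of_four_dvd_card_ge_328` — every finite abelian group of order `≥ 328` divisible by `4` hosts `(2,2,2)¹¹` (record: even `≥ 408`).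

References: H. Cohn, R. Kleinberg, B. Szegedy, C. Umans, FOCS 2005 (arXiv:math/0511460), Def. 5.1.  Seat pub-omega ENG2 (gen 36), 2026-08-29.
-/

open Literature.Computability.AlgebraicComplexity Finset

universe u

namespace Summit.MatrixMultiplication.OmegaCensus

/-- **`(1,2,2)¹¹ ⊆ ℤ/2n` for every `n ≥ 82`** (fat lift of the cyclic `(2,1,1)¹¹` ray from `82`). [cite: CohnKleinbergSzegedyUmans2005, Def. 5.1] -/
theorem exists_isSTPP_122pow11_zmod_two_mul (n : ℕ) (hn : 82 ≤ n) :
    ∃ A B C : Fin 11 → Finset (ZMod (2 * n)), IsSTPP A B C ∧ ∀ i, (A i).card = 1 ∧ (B i).card = 2 ∧ (C i).card = 2 :=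
  haveI : NeZero n := ⟨by omega⟩
  exists_isSTPP_122pow_zmod_two_mul_of_211pow (exists_isSTPP_211pow11_zmod_of_le82 n hn)

/-- **Every finite abelian group of even order `≥ 164` hosts `(1,2,2)¹¹`** (even-order lift of the `(2,1,1)¹¹` law at `82`).
[cite: CohnKleinbergSzegedyUmans2005, Def. 5.1] -/
theorem exists_isSTPP_122pow11_of_even_card_ge_164 {G : Type u} [AddCommGroup G] [Finite G] (heven : Even (Nat.card G))
    (hG : 164 ≤ Nat.card G) :
    ∃ A B C : Fin 11 → Finset G, IsSTPP A B C ∧ ∀ i, (A i).card = 1 ∧ (B i).card = 2 ∧ (C i).card = 2 :=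
  exists_isSTPP_122_of_even_card_of_law (N := 82) (fun Q _ _ hQ => exists_isSTPP_211pow11_of_card_ge_82 hQ) heven (by omega)

/-- Every finite abelian group of order `≥ 328` divisible by `4` hosts `(2,2,2)¹¹` (double lift of the `(2,1,1)¹¹` law at `82`).
[cite: CohnKleinbergSzegedyUmans2005, Def. 5.1] -/
theorem exists_isSTPP_222pow11_of_four_dvd_card_ge_328 {G : Type u} [AddCommGroup G] [Finite G] (h4 : 4 ∣ Nat.card G)
    (hG : 328 ≤ Nat.card G) :
    ∃ A B C : Fin 11 → Finset G, IsSTPP A B C ∧ ∀ i, (A i).card = 2 ∧ (B i).card = 2 ∧ (C i).card = 2 :=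
  exists_isSTPP_222_of_four_dvd_card_of_law (N := 82) (fun Q _ _ hQ => exists_isSTPP_211pow11_of_card_ge_82 hQ) h4 (by omega)

end Summit.MatrixMultiplication.OmegaCensus
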